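import Literature.MathematicalPhysics.QuantumFieldTheory.Balaban1983to89.B1Ineq225RegionChain
import Literature.MathematicalPhysics.QuantumFieldTheory.Balaban1983to89.B1Ineq225RegularTorus
import Literature.MathematicalPhysics.QuantumFieldTheory.Balaban1983to89.B2Eq230CondShiftBound

/-!
# `Balaban1983to89.B1Ineq225RegularRegion` — [Balaban1982Higgs1] Prop. 2.1 (2.25) p. 610, VALUE MEMBER, FOR BIG-BLOCK REGIONS `Ω ⊂ T_ε` UNDER
# `R₀` AT EVERY (2.23)-REGULAR FIELD ON THE (Higgs)₂,₃ CARRIER = [Balaban1983RegularityDecay] Theorem (1.10) p. 573 for regions, carrier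
# instance: the letter hypotheses of `B1Ineq225RegionChain.ineq225_value_region_of_inputs` discharged from (2.23) on `Ω` — interior cubes by
# Lemma 2.2/(2.20)/(2.21) in the cube's own gauge (`B1TorusCubeLpInput.cube_inputs_lp`), boundary pieces by Lemma 2.1
# (`B1Lemma21RegularRegion.sNorm_bOp_le_of_bad`)

statement-level skeleton of published theorems with citation tags; proofs where landed; nothing here is a claim about the Yang–Mills mass gap

PDF held: `paper:balaban1982-cmp85-higgs23-i` p. 610 [PDF 8]; `paper:balaban1983-cmp89-regularity-decay` pp. 573–575, 577–579 [PDF 3–5, 7–9] (text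
layer and the ×2 renders re-read; quotation docfix — self-audit after ref-4 gen 45 QUOTE-AUDIT-B1-p35, filed gen 13: the WHAT IS PRINTED block and the
guillemets below quote only printed sentences; no declaration changed).

CITATION HEADER (lean-in-tree rule).  T. Bałaban, *(Higgs)₂,₃ quantum fields in a finite volume. I. A lower bound*, Commun. Math. Phys. **85**
(1982) 603–626 [Balaban1982Higgs1] (Prop. 2.1 (2.23), (2.25) p. 610) and T. Bałaban, *Regularity and decay of lattice Green's functions*, Commun.
Math. Phys. **89** (1983) 571–597 [Balaban1983RegularityDecay] (Theorem (1.10) p. 573; (2.18)–(2.22) pp. 578–579).  Cell `lit-balaban` (HOME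
`run/shared/lean/pub/lit-balaban/`), Phase-2 proof seat **p35** gen 12 (unit `lit-balaban-p35`); SKELETON rows **B1.Prop2.1** / **B1.Eq2.25**
(value member, REGIONS of `T_ε` under `R₀`, concrete carrier — the scope gap left open by gens 10–11 which settled `Ω = T_ε`) and
**B4.Thm1.10(regions, carrier instance)**.  USED BY NAME, never restated: this seat's `B1Ineq225RegionChain.ineq225_value_region_of_inputs`,
`B1TorusCubeLpInput.cube_inputs_lp`, `B1Lemma21RegularRegion.sNorm_bOp_le_of_bad`, `B1TorusRegionCubes.{bOp, Gloc, piece_eq_cube_of_good,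
fld_of_good}`, gen 11's `B1Ineq225RegularTorus.abs_chartScale`, gen 8's `B1TorusCubeChart.{toT_mem_cube, toT_add_e1}`, r14's
`B1Eq353SupNorm.card_blockK`, `B1Ineq18RegularRegion.gammaReg_pos`.

WHAT IS PRINTED.  [B1] p. 610: *«Proposition 2.1. Let a set Ω satisfies Ω = B^k(Ω^{(k)}) and let Ω^{(k)} ⊂ T₁^{(k)} be a sum of big
blocks with M sufficiently large. Further, let a configuration A be regular on Ω in the sense that |(∂^η_μA)(x)| ≤ c(e(L^kε))^{β−1}, x ∈ Ω,
μ = 1, …, d, (2.23) … Then for e(L^kε) sufficiently small and α < 1 there exist positive constants δ₀, c₀, R₀ independent of A, k, Ω and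
depending on d, a, M only, c₀ on α also, such that for an arbitrary function f : Ω → R^N we have … Similarly we have |(D^η_{A,μ}G_k(Ω, A)f)(x)|,
|(G_k(Ω, A)f)(x)| ≤ c₀exp(−δ₀dist(x, supp f))‖f‖_∞ (2.25) for x ∈ Ω, dist(x, Ω^c) ≥ R₀.»*; [B4] p. 573: *«Similarly |(D^η_{A,μ}G_k(Ω, A)f)(x)|,
|(G_k(Ω, A)(x)| ≤ c₀exp(−δ₀dist(x, supp f))‖f‖_∞ (1.10) for x ∈ Ω, dist(x, Ω^c) ≥ R₀.»*; pp. 574–575: *«it is sufficient to prove the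
Proposition for a function f with support in a unit cube Δ₀ = B^k(y₀), y₀ ∈ Ω^{(k)}; the general formulation is obtained by taking the decomposition
f = Σ_{Δ⊂Ω} Δf and summing the inequalities.»*; p. 579 (2.22).

WHAT THIS FILE PROVES (kernel-checked, zero `sorry`; theorems only, no definition, no `Prop` fact).
* §1 `abs_acT_sub_le_of_reg_on` ((2.23) on the sites of `□_j` ⇒ the chart-form regularity `h17` of `cube_inputs_lp` at `□_j`),
  `lpT_two_le_of_card_le` / **`lpT_two_le_of_blockK`** (`‖f‖_{2,η} ≤ ‖f‖_∞` for `f` supported in a `K`-block: `|B^K(y)| = L^{Kd} = vol`, so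
  `V = 1` — the print's reduction to «a function f with support in a unit cube Δ₀ = B^k(y₀)»), `bOp_of_good` / `Gloc_of_good` (at interior
  cubes the region letters ARE the
  cube letters of `B1TorusCubeLpInput`), `rS_le_real` (`rS ≤ 3M/4`).
* §2 **`norm_propagatorK_region_reg_decay`** — PROP. 2.1 (2.25) VALUE MEMBER FOR BIG-BLOCK REGIONS UNDER `R₀` AT EVERY (2.23)-REGULAR `A`:
  for `d ≥ 1`, `L ≥ 2`, `a > 0`, `m² > 0`, `N`, `(e, q)`, a mesh cap `ε₀` and a regularity pair `(c, β)`: constants `c₀ > 0`, `K₀min` and, per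
  cube size `K₀ ≥ K₀min`, a threshold `e₁ > 0` such that on every torus of the carrier with `K₀ ∣ M`, at every level `1 ≤ K ≤ K_P` with
  `3L^KK₀ ≤ |T_ε|_μ`, `L^Kε ≤ ε₀`, for every BIG-BLOCK UNION `Ω`, every vector field `A` and `0 < e_K ≤ e₁` with (2.23) ON `Ω`, every site
  `x` with `{|y − x| ≤ 2rS + 2M(d+1)} ⊂ Ω` (`R₀ = O(dM)`), every `g` supported in a `K`-block with `‖g‖_∞ ≤ M′` vanishing at the sites within
  distance `< D` of `x`: `‖(G^ε_K(Ω, A)1_Ωg)(x)‖ ≤ c₀(L^Kε)²·exp(−D/(2K₀L^K))·M′` (`δ₀ = 1/(2K₀)` per `L^Kε`; `c₀ = 2·2^d·C_γ·e^{3/2}`).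
* §3 `blockPiece` (the restriction of `g` to a `K`-block), `sum_blockPiece`, and **`norm_propagatorK_region_reg_decay_sum`** — THE SAME FOR
  ARBITRARY `g` («taking the decomposition f = Σ_{Δ⊂Ω} Δf and summing the inequalities» over the `K`-blocks with r14's `tdist_blockIter_le_real`
  and the uniform
  torus sum `B2Eq230CondShiftBound.sum_exp_neg_tdist_le` on `T^{(K)}`): `‖(G^ε_K(Ω, A)1_Ωg)(x)‖ ≤ c₀(K₀)(L^Kε)²·exp(−D/(4K₀L^K))·M′` with
  `c₀(K₀) = 2·2^dC_γe^{3/2}·e^{1/(4K₀)}·K_d(1/(4K₀))` (a constant depending on `d` and `M = K₀` — the print's «depending on d, a, M only»).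
HONEST SCOPE.  (i) Value member only; the kernel form, the derivative member, (2.24) and (2.26) for regions are separate rows.  (ii) `Ω` a
big-block union (union of translates of `[0, M)^d` on the `M`-grid) — the print's «let Ω^{(k)} ⊂ T₁^{(k)} be a sum of big blocks» p. 610;
`R₀` in site form
`{|y − x| ≤ 2rS + 2M(d+1)} ⊂ Ω`.  (iii) (2.23) is used on `Ω` only.
Unit `lit-balaban-p35` gen 12 (literature-prover-lit-balaban-p35-g12-0).
-/

open scoped BigOperators

noncomputable section

namespace Literature.MathematicalPhysics.QuantumFieldTheory.Balaban1983to89.B1Ineq225RegularRegion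

open Literature.MathematicalPhysics.QuantumFieldTheory.Balaban1983to89.HiggsLattice
open Literature.MathematicalPhysics.QuantumFieldTheory.Balaban1983to89.HiggsAveraging
open Literature.MathematicalPhysics.QuantumFieldTheory.Balaban1983to89.HiggsCovariance
open Literature.MathematicalPhysics.QuantumFieldTheory.Balaban1983to89.HiggsCovariancePos
open Literature.MathematicalPhysics.QuantumFieldTheory.Balaban1983to89.HiggsCovarianceCont (sNorm sNorm_nonneg sNorm_smul)
open Literature.MathematicalPhysics.QuantumFieldTheory.Balaban1983to89.B1TorusCubeCover
open Literature.MathematicalPhysics.QuantumFieldTheory.Balaban1983to89.B1TorusCubeLocality26 (rS cubeVec)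
open Literature.MathematicalPhysics.QuantumFieldTheory.Balaban1983to89.B1TorusCubeChart (dd castD toT toT_add_e1 toT_mem_cube M2 predL_succ)
open Literature.MathematicalPhysics.QuantumFieldTheory.Balaban1983to89.B1TorusCubeBoxOp (acT)
open Literature.MathematicalPhysics.QuantumFieldTheory.Balaban1983to89.B4Lemma22ReduceZero (Box)
open Literature.MathematicalPhysics.QuantumFieldTheory.Balaban1983to89.B4Lower18Regular (e1)
open Literature.MathematicalPhysics.QuantumFieldTheory.Balaban1983to89.B4Lemma22EtaBox (vol vol_pos)
open Literature.MathematicalPhysics.QuantumFieldTheory.Balaban1983to89.B4Lemma22LpStair (lpS lpS_nonneg)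
open Literature.MathematicalPhysics.QuantumFieldTheory.Balaban1983to89.B4PartitionUnity22 (hprof D1 D2 D1_nonneg D2_nonneg contDiff_hprof
  hasCompactSupport_hprof)
open Literature.MathematicalPhysics.QuantumFieldTheory.Balaban1983to89.B1TorusRegionCubes
open Literature.MathematicalPhysics.QuantumFieldTheory.Balaban1983to89.B1TorusRegionHSizes (IsBigBlockUnion)
open Literature.MathematicalPhysics.QuantumFieldTheory.Balaban1983to89.B1TorusRegionRop (chi)
open Literature.MathematicalPhysics.QuantumFieldTheory.Balaban1983to89.B1Lemma21RegularRegion (sNorm_bOp_le_of_bad)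
open Literature.MathematicalPhysics.QuantumFieldTheory.Balaban1983to89.B1TorusCubeLpInput (lpT lpT_def lpT_nonneg cube_inputs_lp)
open Literature.MathematicalPhysics.QuantumFieldTheory.Balaban1983to89.B1Ineq225RegionChain
open Literature.MathematicalPhysics.QuantumFieldTheory.Balaban1983to89.B1Ineq225RegularTorus (abs_chartScale)
open Literature.MathematicalPhysics.QuantumFieldTheory.Balaban1983to89.B1Ineq18RegularRegion (gammaReg_pos)
open Literature.MathematicalPhysics.QuantumFieldTheory.Balaban1983to89.B1Eq353SupNorm (card_blockK)
open Literature.MathematicalPhysics.QuantumFieldTheory.Balaban1983to89.B1Ineq234Concrete (tdist_blockIter_le_real)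
open Literature.MathematicalPhysics.QuantumFieldTheory.Balaban1983to89.B2Eq230CondShiftBound (sum_exp_neg_tdist_le)
open Literature.MathematicalPhysics.QuantumFieldTheory.Balaban1983to89.B4Sect5Proof (latticeConst latticeConst_nonneg)

variable {P : HiggsLattice.Params} {N : ℕ}

/-! ## §1 (2.23) on a cube, `V = 1` on a `K`-block, and the interior letters -/

section Inputs

variable {K K₀ : ℕ}

/-- **(2.23) ON THE SITES OF `□_j` ⇒ THE CHART-FORM REGULARITY `h17` AT `□_j`** (gen 11's `abs_acT_sub_le_of_reg` with the hypothesis only on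
the cube: the transcribed field is read at `toT y ∈ □_j`). [cite: Balaban1982Higgs1, Prop. 2.1 (2.23) p.610] -/
theorem abs_acT_sub_le_of_reg_on (hK : K ≤ P.K) (hK₀ : K₀ ∣ P.M) (hK₀' : 1 ≤ K₀) (C : ChargeData N) (j : Lab P K K₀)
    (A : HiggsLattice.VecField P 0) {ec creg β : ℝ} (hec : 0 < ec)
    (hreg : ∀ x ∈ cube K K₀ j, ∀ μ ν : Fin P.d,
      P.mesh K * |C.e| / ec * |A ⟨x.shift μ, ν⟩ - A ⟨x, ν⟩| ≤ creg * ec ^ (β - 1) / (P.L : ℝ) ^ K) :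
    ∀ y ∈ Box (dd P) (P.L - 1) K (M2 P K₀), ∀ i i' : Fin (dd P + 1),
      |acT K K₀ j ((((P.L - 1 + 1) ^ K : ℕ) : ℝ) * P.mesh 0 * C.e / ec) A (y + e1 i) i'
        - acT K K₀ j ((((P.L - 1 + 1) ^ K : ℕ) : ℝ) * P.mesh 0 * C.e / ec) A y i'|
        ≤ creg * ec ^ (β - 1) / ((P.L - 1 + 1) ^ K : ℕ) := by
  intro y hy i i'
  have hnR : ((((P.L - 1 + 1) ^ K : ℕ)) : ℝ) = (P.L : ℝ) ^ K := by rw [predL_succ, Nat.cast_pow]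
  unfold acT
  rw [toT_add_e1, ← mul_sub, abs_mul, abs_chartScale C K hec, hnR]
  exact hreg _ (toT_mem_cube hK hK₀ hK₀' j hy) _ _

/-- `‖f‖_{2,η} ≤ ‖f‖_∞` for `f` supported on a set of at most `vol = L^{Kd}` sites (the factor `‖f‖₂ ≤ ‖f‖_∞` in (2.21) for `f` with
support in a unit cube). [cite: Balaban1983RegularityDecay, pp.574–575 «it is sufficient to prove the Proposition for a function f with support
in a unit cube Δ₀ = B^k(y₀)», (2.21) p.578] -/
theorem lpT_two_le_of_card_le (S : Finset (HiggsLattice.Site P 0)) (hS : (S.card : ℝ) ≤ vol (dd P) (P.L - 1) K)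
    {f : HiggsLattice.ScalarField P 0 N} (hf : ∀ y, y ∉ S → f y = 0) : lpT K 2 f ≤ ‖f‖ := by
  classical
  have hv := vol_pos (dd P) (P.L - 1) K
  have hsum : ∑ x : HiggsLattice.Site P 0, ‖f x‖ ^ 2 ≤ vol (dd P) (P.L - 1) K * ‖f‖ ^ 2 := by
    have h1 : ∑ x : HiggsLattice.Site P 0, ‖f x‖ ^ 2 = ∑ x ∈ S, ‖f x‖ ^ 2 :=
      (Finset.sum_subset (Finset.subset_univ S) fun x _ hx => by rw [hf x hx, norm_zero]; ring).symm
    rw [h1]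
    calc ∑ x ∈ S, ‖f x‖ ^ 2 ≤ ∑ _x ∈ S, ‖f‖ ^ 2 :=
          Finset.sum_le_sum fun x _ => pow_le_pow_left₀ (norm_nonneg _) (norm_le_pi_norm f x) 2
      _ = S.card * ‖f‖ ^ 2 := by rw [Finset.sum_const, nsmul_eq_mul]
      _ ≤ vol (dd P) (P.L - 1) K * ‖f‖ ^ 2 := mul_le_mul_of_nonneg_right hS (sq_nonneg _)
  rw [lpT_two_eq]
  have hs : 0 < Real.sqrt (P.mesh 0 ^ P.d) := Real.sqrt_pos.2 (pow_pos (P.mesh_pos 0) _)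
  have hN : sNorm f = Real.sqrt (P.mesh 0 ^ P.d) * Real.sqrt (∑ x : HiggsLattice.Site P 0, ‖f x‖ ^ 2) := by
    unfold sNorm
    rw [siteInner_self_eq, ← Finset.mul_sum, Real.sqrt_mul (pow_nonneg (P.mesh_pos 0).le _)]
  rw [hN, mul_assoc, ← mul_assoc (Real.sqrt (P.mesh 0 ^ P.d))⁻¹, inv_mul_cancel₀ hs.ne', one_mul]
  have hhalf : (vol (dd P) (P.L - 1) K)⁻¹ ^ (2 : ℝ)⁻¹ = Real.sqrt ((vol (dd P) (P.L - 1) K)⁻¹) := by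
    rw [Real.sqrt_eq_rpow, show ((2 : ℝ)⁻¹) = 1 / 2 by norm_num]
  rw [hhalf, ← Real.sqrt_mul (inv_nonneg.2 hv.le)]
  calc Real.sqrt ((vol (dd P) (P.L - 1) K)⁻¹ * ∑ x : HiggsLattice.Site P 0, ‖f x‖ ^ 2)
      ≤ Real.sqrt ((vol (dd P) (P.L - 1) K)⁻¹ * (vol (dd P) (P.L - 1) K * ‖f‖ ^ 2)) :=
        Real.sqrt_le_sqrt (mul_le_mul_of_nonneg_left hsum (inv_nonneg.2 hv.le))
    _ = ‖f‖ := by rw [← mul_assoc, inv_mul_cancel₀ hv.ne', one_mul, Real.sqrt_sq (norm_nonneg _)]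

/-- **`V = 1` ON A `K`-BLOCK**: `‖f‖_{2,η} ≤ ‖f‖_∞` for `f` supported in the `K`-block `B^K(y₀)` (`|B^K(y₀)| = L^{Kd} = vol`, `K ≤ K_P`).
[cite: Balaban1983RegularityDecay, (2.21) p.578] -/
theorem lpT_two_le_of_blockK (hK : K ≤ P.K) (y₀ : HiggsLattice.Site P 0) {f : HiggsLattice.ScalarField P 0 N}
    (hf : ∀ y, blockIter K y ≠ blockIter K y₀ → f y = 0) : lpT K 2 f ≤ ‖f‖ := by
  refine lpT_two_le_of_card_le (blockK K (blockIter K y₀)) (le_of_eq ?_) fun y hy => hf y fun h => hy ((mem_blockK K _ y).2 h)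
  rw [card_blockK hK]
  unfold vol
  rw [predL_succ]
  unfold dd
  rw [Nat.sub_add_cancel P.hd]
  push_cast
  rw [← pow_mul]

variable (C : ChargeData N) (Ω : Finset (HiggsLattice.Site P 0)) (A : HiggsLattice.VecField P 0) (msq a : ℝ)

/-- At an interior cube the local propagator is the cube propagator in the cube's own gauge. [cite: Balaban1983RegularityDecay, §2 p.575] -/
theorem Gloc_of_good {j : Lab P K K₀} (h : cube K K₀ j ⊆ Ω) :
    Gloc C K K₀ Ω A msq a j = propagatorK C (cube K K₀ j) (cubeVec K K₀ j A) msq a K := by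
  unfold Gloc
  rw [piece_eq_cube_of_good h, fld_of_good h]

/-- **AT AN INTERIOR CUBE THE REGION LETTER IS (MINUS) THE CUBE LETTER** of `B1TorusCubeLpInput.cube_inputs_lp`.
[cite: Balaban1983RegularityDecay, (2.11) p.576] -/
theorem bOp_of_good {j : Lab P K K₀} (h : cube K K₀ j ⊆ Ω) (ψ : HiggsLattice.ScalarField P 0 N) :
    bOp C K K₀ Ω A msq a j ψ
      = -(covOpK C (cube K K₀ j) (cubeVec K K₀ j A) msq a K
            (hTor K K₀ j • propagatorK C (cube K K₀ j) (cubeVec K K₀ j A) msq a K (hTor K K₀ j • ψ))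
          - hTor K K₀ j • covOpK C (cube K K₀ j) (cubeVec K K₀ j A) msq a K
            (propagatorK C (cube K K₀ j) (cubeVec K K₀ j A) msq a K (hTor K K₀ j • ψ))) := by
  rw [bOp_apply]
  unfold Hloc Gloc
  rw [piece_eq_cube_of_good h, fld_of_good h]

/-- `rS ≤ 3M/4` for `K₀ ≥ 8` (`rS = 5M/8 + L^K`, `L^K = M/K₀`). [cite: Balaban1983RegularityDecay, (2.22) p.579] -/
theorem rS_le_real (hK₀8 : 8 ≤ K₀) : (rS P K K₀ : ℝ) ≤ 3 / 4 * half P K K₀ := by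
  unfold rS half
  have h1 : (((5 * (P.L ^ K * K₀) / 8 : ℕ)) : ℝ) ≤ 5 * ((P.L : ℝ) ^ K * K₀) / 8 := by
    have := Nat.cast_div_le (m := 5 * (P.L ^ K * K₀)) (n := 8) (α := ℝ)
    push_cast at this
    exact this
  have h2 : (P.L : ℝ) ^ K * 8 ≤ (P.L : ℝ) ^ K * K₀ :=
    mul_le_mul_of_nonneg_left (by exact_mod_cast hK₀8) (pow_nonneg (Nat.cast_nonneg _) _)
  push_cast
  linarith

end Inputs

/-! ## §2 Prop. 2.1 (2.25), value member, for big-block regions under `R₀` at every (2.23)-regular field -/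

section Main

set_option maxHeartbeats 800000 in
/-- **PROP. 2.1 (2.25), VALUE MEMBER, FOR BIG-BLOCK REGIONS `Ω ⊂ T_ε` UNDER `R₀`, AT EVERY (2.23)-REGULAR VECTOR FIELD — B4's THEOREM (1.10)
FOR REGIONS ON THE CARRIER.**  For `d ≥ 1`, `L ≥ 2`, `a > 0`, `m² > 0`, `N`, `(e, q)`, a mesh cap `ε₀` and a regularity pair `c ≥ 0`, `β > 0`:
constants `c₀ > 0`, `K₀min`, and for every cube size `K₀ ≥ K₀min` a threshold `e₁ > 0` («e(L^kε) sufficiently small») such that on EVERY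
torus of the carrier with `K₀ ∣ M`, at every level `1 ≤ K ≤ K_P` with `3·L^KK₀ ≤ |T_ε|_μ` and `L^Kε ≤ ε₀`, for EVERY big-block union `Ω`,
EVERY vector field `A` and `0 < e_K ≤ e₁` with (2.23) ON `Ω` in the form `(L^Kε|e|/e_K)|A_ν(z + εe_μ) − A_ν(z)| ≤ c·e_K^{β−1}/L^K`
(`z ∈ Ω`), every site `x` with `{y : |y − x| ≤ 2rS + 2M(d + 1)} ⊂ Ω` (the `R₀` restriction), every `g` supported in a `K`-block with
`‖g‖_∞ ≤ M′` vanishing at the sites within lattice distance `< D` of `x` (`D ≥ 0`):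
`‖(G^ε_K(Ω, A)1_Ωg)(x)‖ ≤ c₀(L^Kε)²·exp(−D/(2K₀L^K))·M′`.  Proof = `ineq225_value_region_of_inputs` (the printed walk expansion with
`n₀ = d` graded norms) fed at interior cubes by `cube_inputs_lp` under (2.23) read through the chart, at boundary pieces by
`sNorm_bOp_le_of_bad`, with `V = 1` on a `K`-block and `3^d·max(C_β, C_b)/K₀ ≤ e^{−1}` for `K₀ ≥ K₀min`.
[cite: Balaban1982Higgs1, Prop. 2.1 (2.23), (2.25) p.610] [cite: Balaban1983RegularityDecay, Theorem (1.10) p.573; (2.18)–(2.22) pp.578–579] -/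
theorem norm_propagatorK_region_reg_decay (d L : ℕ) (hd : 1 ≤ d) (hL : 2 ≤ L) {a : ℝ} (ha : 0 < a) {msq : ℝ} (hmsq : 0 < msq)
    (N : ℕ) (C : ChargeData N) (ε₀ : ℝ) (creg β : ℝ) (hcreg : 0 ≤ creg) (hβ : 0 < β) :
    ∃ c₀ : ℝ, 0 < c₀ ∧ ∃ K₀min : ℕ, ∀ K₀ : ℕ, K₀min ≤ K₀ → ∃ e₁ : ℝ, 0 < e₁ ∧
      ∀ (P : HiggsLattice.Params), P.d = d → P.L = L → K₀ ∣ P.M →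
      ∀ {K : ℕ}, 1 ≤ K → K ≤ P.K → (∀ μ, 3 * half P K K₀ ≤ P.sitesPerDir 0 μ) → P.mesh K ≤ ε₀ →
      ∀ (Ω : Finset (HiggsLattice.Site P 0)), IsBigBlockUnion K K₀ Ω →
      ∀ (A : HiggsLattice.VecField P 0) {ec : ℝ}, 0 < ec → ec ≤ e₁ →
      (∀ z ∈ Ω, ∀ μ ν : Fin P.d,
          P.mesh K * |C.e| / ec * |A ⟨z.shift μ, ν⟩ - A ⟨z, ν⟩| ≤ creg * ec ^ (β - 1) / (P.L : ℝ) ^ K) →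
      ∀ (x : HiggsLattice.Site P 0),
        (∀ y, HiggsLattice.Site.tdist x y ≤ 2 * rS P K K₀ + 2 * half P K K₀ * (P.d + 1) → y ∈ Ω) →
        ∀ (y₀ : HiggsLattice.Site P 0) (g : HiggsLattice.ScalarField P 0 N) (M D : ℝ),
          (∀ y, blockIter K y ≠ blockIter K y₀ → g y = 0) → (∀ y, ‖g y‖ ≤ M) → 0 ≤ D →
          (∀ z, g z ≠ 0 → D ≤ (HiggsLattice.Site.tdist x z : ℝ)) →
            ‖propagatorK C Ω A msq a K (chi Ω • g) x‖
              ≤ c₀ * P.mesh K ^ 2 * Real.exp (-(D / (2 * K₀ * (P.L : ℝ) ^ K))) * M := by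
  have hℓ0 : 1 ≤ L - 1 := by omega
  have hp₁ : (((d - 1 : ℕ)) : ℝ) + 1 < 2 * d := by
    rw [Nat.cast_sub hd, Nat.cast_one]
    have : (1 : ℝ) ≤ d := by exact_mod_cast hd
    linarith
  obtain ⟨Cγ, Cβ, hCγ, hCβ, hcube⟩ := cube_inputs_lp C (d - 1) (L - 1) hℓ0 a a (msq * ε₀ ^ 2) ha hp₁
  -- the boundary-piece constant of Lemma 2.1 (depends on `d, L, a` only)
  have hLr : (1 : ℝ) < L := by exact_mod_cast (show 1 < L by omega)
  set γ₀ : ℝ := min 2 (a * (1 - (((L : ℕ) : ℝ) ^ 2)⁻¹) / 4) with hγ₀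
  have hγ₀pos : 0 < γ₀ := by
    have h1 : (((L : ℕ) : ℝ) ^ 2)⁻¹ < 1 := inv_lt_one_of_one_lt₀ (by nlinarith)
    exact lt_min (by norm_num) (by nlinarith [mul_pos ha (show (0 : ℝ) < 1 - (((L : ℕ) : ℝ) ^ 2)⁻¹ by linarith)])
  set Cb : ℝ := ((((d - 1 : ℕ)) : ℝ) + 1) * (D1 hprof + D2 hprof) * (γ₀⁻¹ + 2 * Real.sqrt (d * γ₀⁻¹) + a * γ₀⁻¹) with hCb
  have hD1 := D1_nonneg contDiff_hprof hasCompactSupport_hprof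
  have hD2 := D2_nonneg contDiff_hprof hasCompactSupport_hprof
  have hCb0 : 0 ≤ Cb := by
    have := inv_nonneg.2 hγ₀pos.le
    have := Real.sqrt_nonneg (d * γ₀⁻¹)
    positivity
  set Cm : ℝ := max Cβ Cb with hCm
  have hCm0 : 0 < Cm := lt_of_lt_of_le hCβ (le_max_left _ _)
  refine ⟨2 * 2 ^ d * Cγ * Real.exp (3 / 2), by positivity, max 8 ⌈(3 : ℝ) ^ d * Cm * Real.exp 1⌉₊, fun K₀ hK₀ => ?_⟩
  have hK₀8 : 8 ≤ K₀ := le_trans (le_max_left _ _) hK₀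
  have hK₀r : (0 : ℝ) < K₀ := by exact_mod_cast lt_of_lt_of_le (by norm_num) hK₀8
  have hK₀C : (3 : ℝ) ^ d * Cm * Real.exp 1 ≤ K₀ :=
    (Nat.le_ceil _).trans (by exact_mod_cast le_trans (le_max_right _ _) hK₀)
  obtain ⟨e₁, he₁, hcubeK⟩ := hcube creg β hcreg hβ K₀ hK₀8
  -- the smallness of `e_K` for Lemma 2.1 at the boundary pieces: `d²·c·e_K^β ≤ 1/3`
  set es : ℝ := ((3 * ((d : ℝ) ^ 2 * creg + 1))⁻¹) ^ β⁻¹ with hes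
  have hin : 0 < (3 * ((d : ℝ) ^ 2 * creg + 1))⁻¹ := by positivity
  have hes0 : 0 < es := Real.rpow_pos_of_pos hin _
  refine ⟨min e₁ es, lt_min he₁ hes0, ?_⟩
  intro P hPd hPL hK₀M K hK1 hK hN3 hε Ω hΩ A ec hec hle hreg x hR y₀ g M D hg hgM hD0 hD
  subst hPd
  have hdd : dd P = P.d - 1 := rfl
  have hPL1 : P.L - 1 = L - 1 := by rw [hPL]
  have hL1 : 1 < P.L := by rw [hPL]; omega
  have hL1r : (1 : ℝ) < P.L := by exact_mod_cast hL1
  have hak : 0 ≤ B1.aSeq a P.L K := (B1.aSeq_pos ha hL1r hK1).le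
  have hK₀' : 1 ≤ K₀ := le_trans (by norm_num) hK₀8
  have hmesh : 0 < P.mesh K := P.mesh_pos K
  have hcap : msq * P.mesh K ^ 2 ≤ msq * ε₀ ^ 2 := mul_le_mul_of_nonneg_left (pow_le_pow_left₀ hmesh.le hε 2) hmsq.le
  have hM0 : 0 ≤ M := (norm_nonneg _).trans (hgM x)
  have hgn : ‖g‖ ≤ M := (pi_norm_le_iff_of_nonneg hM0).2 hgM
  -- the letter constant and its smallness
  set βK : ℝ := Cm / K₀ with hβK
  have hβK0 : 0 ≤ βK := div_nonneg hCm0.le hK₀r.le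
  have hCβK : Cβ / K₀ ≤ βK := div_le_div_of_nonneg_right (le_max_left _ _) hK₀r.le
  have hCbK : Cb / K₀ ≤ βK := div_le_div_of_nonneg_right (le_max_right _ _) hK₀r.le
  have hDβ : (3 : ℝ) ^ P.d * βK ≤ Real.exp (-1) := by
    rw [hβK, mul_div_assoc', div_le_iff₀ hK₀r]
    have h1 : Real.exp (-1) * Real.exp 1 = 1 := by rw [← Real.exp_add]; norm_num
    have h2 : (3 : ℝ) ^ P.d * Cm = (3 : ℝ) ^ P.d * Cm * Real.exp 1 * Real.exp (-1) := by
      rw [mul_assoc ((3 : ℝ) ^ P.d * Cm), mul_comm (Real.exp 1), h1, mul_one]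
    rw [h2]
    exact mul_le_mul_of_nonneg_right hK₀C (Real.exp_pos _).le |>.trans_eq (mul_comm _ _)
  -- the cube inputs at the interior cubes
  have hcj : ∀ j : Lab P K K₀, cube K K₀ j ⊆ Ω → _ := fun j hj =>
    hcubeK P hdd hPL1 K hK1 hK hK₀M hN3 a msq le_rfl le_rfl hmsq hcap j A ec hec (hle.trans (min_le_left _ _))
      (abs_acT_sub_le_of_reg_on hK hK₀M hK₀' C j A hec fun z hz μ ν => hreg z (hj hz) μ ν)
  -- the smallness `d²·c·e_K^β ≤ 1/3`
  have hsmall : (P.d : ℝ) ^ 2 * creg * ec ^ β ≤ 1 / 3 := by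
    have h1 : ec ^ β ≤ es ^ β := Real.rpow_le_rpow hec.le (hle.trans (min_le_right _ _)) hβ.le
    have h2 : es ^ β = (3 * ((P.d : ℝ) ^ 2 * creg + 1))⁻¹ := by rw [hes, Real.rpow_inv_rpow hin.le hβ.ne']
    rw [h2] at h1
    have h3 : (P.d : ℝ) ^ 2 * creg * ec ^ β ≤ (P.d : ℝ) ^ 2 * creg * (3 * ((P.d : ℝ) ^ 2 * creg + 1))⁻¹ :=
      mul_le_mul_of_nonneg_left h1 (by positivity)
    refine h3.trans ?_
    rw [← div_eq_mul_inv, div_le_div_iff₀ (by positivity) (by norm_num)]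
    nlinarith [sq_nonneg (P.d : ℝ), mul_nonneg (sq_nonneg (P.d : ℝ)) hcreg]
  have hreg' : ∀ z ∈ Ω, ∀ μ ν : Fin P.d,
      P.mesh K * |C.e| / ec * |A ⟨z.shift ν, μ⟩ - A ⟨z, μ⟩| ≤ creg * ec ^ (β - 1) / (P.L : ℝ) ^ K :=
    fun z hz μ ν => hreg z hz ν μ
  -- the `L²` letter at every piece
  have h2 : ∀ (j : Lab P K K₀) (ψ : HiggsLattice.ScalarField P 0 N), (∀ y, y ∉ Ω → ψ y = 0) →
      sNorm (bOp C K K₀ Ω A msq a j ψ) ≤ βK * sNorm ψ := by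
    intro j ψ hψ
    by_cases hj : cube K K₀ j ⊆ Ω
    · -- interior cube: the (2, 2) letter of (2.21), transferred to the (1.5) norm
      have h22 := (hcj j hj).2.2.1 2 2 (by norm_num) le_rfl (by rw [sub_self]; positivity) ψ
      have hc := cTwo_pos P K
      rw [lpT_two_eq, lpT_two_eq, mul_left_comm (Cβ / (K₀ : ℝ))] at h22
      have h3 := le_of_mul_le_mul_left h22 hc
      rw [bOp_of_good C Ω A msq a hj ψ, ← neg_one_smul ℝ, sNorm_smul, abs_neg, abs_one, one_mul]
      exact h3.trans (mul_le_mul_of_nonneg_right hCβK (sNorm_nonneg _))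
    · -- boundary piece: Lemma 2.1
      have hb := sNorm_bOp_le_of_bad C ha hL1 hmsq hK1 hK hK₀M hK₀8 hN3 hΩ A hec hreg' hsmall hj ψ hψ
      refine hb.trans (mul_le_mul_of_nonneg_right (le_trans (le_of_eq ?_) hCbK) (sNorm_nonneg _))
      rw [hCb, hγ₀, hPL, hdd]
  -- the chain
  have hmain := ineq225_value_region_of_inputs C Ω A hK hK₀M hK₀8 hN3 hΩ hmsq hak (n₀ := P.d) P.hd
    (γ := Cγ * P.mesh K ^ 2) (β := βK) (by positivity) hβK0 hDβ
    (fun j hj ψ => by rw [Gloc_of_good C Ω A msq a hj]; exact (hcj j hj).1 ψ)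
    (fun j hj ψ => by
      rw [bOp_of_good C Ω A msq a hj ψ, norm_neg]
      exact ((hcj j hj).2.1 ψ).trans (mul_le_mul_of_nonneg_right hCβK (norm_nonneg _)))
    (fun j hj p q h1p hpq hdiff ψ => by
      rw [bOp_of_good C Ω A msq a hj ψ, lpT_neg]
      exact ((hcj j hj).2.2.1 p q h1p hpq hdiff ψ).trans (mul_le_mul_of_nonneg_right hCβK (lpT_nonneg _ _)))
    (fun j hj ψ => by
      rw [bOp_of_good C Ω A msq a hj ψ, norm_neg]
      exact ((hcj j hj).2.2.2 (2 * P.d) le_rfl ψ).trans (mul_le_mul_of_nonneg_right hCβK (lpT_nonneg _ _)))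
    h2 x hR g (Dist := ⌈D⌉₊) (fun y hy => Nat.ceil_le.2 (hD y hy)) (V := 1) le_rfl
    (by rw [one_mul]; exact lpT_two_le_of_blockK hK y₀ hg)
  refine hmain.trans ?_
  -- the exponent: `(⌈D⌉ − 4rS)/(2M) ≥ D/(2K₀L^K) − 3/2`
  have hh : (half P K K₀ : ℝ) = (P.L : ℝ) ^ K * K₀ := by unfold half; push_cast; ring
  have hhpos : (0 : ℝ) < half P K K₀ := by exact_mod_cast half_pos hK₀'
  have hrS := rS_le_real (P := P) (K := K) hK₀8
  have hexp : Real.exp (-(((⌈D⌉₊ : ℝ) - 4 * rS P K K₀) / (2 * half P K K₀)))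
      ≤ Real.exp (3 / 2) * Real.exp (-(D / (2 * K₀ * (P.L : ℝ) ^ K))) := by
    rw [← Real.exp_add]
    refine Real.exp_le_exp.2 ?_
    have hDc : D ≤ (⌈D⌉₊ : ℝ) := Nat.le_ceil D
    have e1 : D / (2 * K₀ * (P.L : ℝ) ^ K) = D / (2 * half P K K₀) := by rw [hh]; ring_nf
    rw [e1]
    have h4 : (4 * (rS P K K₀ : ℝ)) ≤ 3 * half P K K₀ := by linarith
    have e2 : ((⌈D⌉₊ : ℝ) - 4 * rS P K K₀) / (2 * half P K K₀) - D / (2 * half P K K₀)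
        = ((⌈D⌉₊ : ℝ) - D - 4 * rS P K K₀) / (2 * half P K K₀) := by ring
    have h5 : -(3 / 2 : ℝ) ≤ ((⌈D⌉₊ : ℝ) - D - 4 * rS P K K₀) / (2 * half P K K₀) := by
      rw [le_div_iff₀ (by positivity)]
      linarith
    linarith
  calc 2 * 2 ^ P.d * (Cγ * P.mesh K ^ 2) * 1 * Real.exp (-(((⌈D⌉₊ : ℝ) - 4 * rS P K K₀) / (2 * half P K K₀))) * ‖g‖
      ≤ 2 * 2 ^ P.d * (Cγ * P.mesh K ^ 2) * 1 * (Real.exp (3 / 2) * Real.exp (-(D / (2 * K₀ * (P.L : ℝ) ^ K)))) * M :=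
        mul_le_mul (mul_le_mul_of_nonneg_left hexp (by positivity)) hgn (norm_nonneg _) (by positivity)
    _ = 2 * 2 ^ P.d * Cγ * Real.exp (3 / 2) * P.mesh K ^ 2 * Real.exp (-(D / (2 * K₀ * (P.L : ℝ) ^ K))) * M := by ring

end Main


/-! ## §3 Summation over the `K`-blocks: arbitrary `g` -/

section Sum

variable {K : ℕ}

/-- The restriction of `g` to the `K`-block `B^K(b)` (the pieces `Δf` of «the decomposition f = Σ_{Δ⊂Ω} Δf»).
[cite: Balaban1983RegularityDecay, pp.574–575] -/
def blockPiece (K : ℕ) (b : HiggsLattice.Site P K) (g : HiggsLattice.ScalarField P 0 N) : HiggsLattice.ScalarField P 0 N :=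
  fun y => if blockIter K y = b then g y else 0

/-- `g = Σ_b g|_{B^K(b)}`. [cite: Balaban1983RegularityDecay, (2.21) p.578] -/
theorem sum_blockPiece (g : HiggsLattice.ScalarField P 0 N) : ∑ b : HiggsLattice.Site P K, blockPiece K b g = g := by
  funext y
  rw [Finset.sum_apply, Finset.sum_eq_single (blockIter K y)]
  · simp [blockPiece]
  · intro b _ hb
    simp [blockPiece, Ne.symm hb]
  · intro h; exact absurd (Finset.mem_univ _) h

/-- The block piece is supported in its block. [cite: Balaban1983RegularityDecay, (2.21) p.578] -/
theorem blockPiece_supported (b : HiggsLattice.Site P K) (g : HiggsLattice.ScalarField P 0 N) {y₀ : HiggsLattice.Site P 0}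
    (hy₀ : blockIter K y₀ = b) : ∀ y, blockIter K y ≠ blockIter K y₀ → blockPiece K b g y = 0 := by
  intro y hy
  unfold blockPiece
  rw [if_neg (by rw [hy₀] at hy; exact hy)]

/-- `‖g|_B(y)‖ ≤ ‖g(y)‖`. [cite: Balaban1983RegularityDecay, (2.21) p.578] -/
theorem norm_blockPiece_apply_le (b : HiggsLattice.Site P K) (g : HiggsLattice.ScalarField P 0 N) (y : HiggsLattice.Site P 0) :
    ‖blockPiece K b g y‖ ≤ ‖g y‖ := by
  unfold blockPiece
  split_ifs
  · exact le_rfl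
  · rw [norm_zero]; exact norm_nonneg _

set_option maxHeartbeats 800000 in
/-- **PROP. 2.1 (2.25), VALUE MEMBER, FOR BIG-BLOCK REGIONS UNDER `R₀` AT EVERY (2.23)-REGULAR FIELD, ARBITRARY `g`** — B4's THEOREM (1.10)
FOR REGIONS ON THE CARRIER in the operator form of gens 10–11: same data as `norm_propagatorK_region_reg_decay`; constants `K₀min` and, for
every `K₀ ≥ K₀min`, `c₀(K₀), e₁(K₀) > 0` such that … for EVERY `g` with `‖g‖_∞ ≤ M′` vanishing at the sites within distance `< D` of `x`:
`‖(G^ε_K(Ω, A)1_Ωg)(x)‖ ≤ c₀(K₀)(L^Kε)²·exp(−D/(4K₀L^K))·M′`.  Proof: `g = Σ_b g|_{B^K(b)}` over the sites `b` of `T^{(K)}`; each piece is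
within the previous theorem with `D_b = max(D, L^K(|x_K − b| − 1))` (r14's `tdist_blockIter_le_real`), `e^{−D_b/(2K₀L^K)} ≤
e^{−D/(4K₀L^K)}e^{1/(4K₀)}e^{−|x_K − b|/(4K₀)}`, and `Σ_b e^{−|x_K − b|/(4K₀)} ≤ K_d(1/(4K₀))` uniformly on `T^{(K)}`.
[cite: Balaban1982Higgs1, Prop. 2.1 (2.23), (2.25) p.610] [cite: Balaban1983RegularityDecay, Theorem (1.10) p.573, pp.574–575 «taking the
decomposition f = Σ_{Δ⊂Ω} Δf and summing the inequalities»; (2.21)–(2.22) pp.578–579] -/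
theorem norm_propagatorK_region_reg_decay_sum (d L : ℕ) (hd : 1 ≤ d) (hL : 2 ≤ L) {a : ℝ} (ha : 0 < a) {msq : ℝ} (hmsq : 0 < msq)
    (N : ℕ) (C : ChargeData N) (ε₀ : ℝ) (creg β : ℝ) (hcreg : 0 ≤ creg) (hβ : 0 < β) :
    ∃ K₀min : ℕ, ∀ K₀ : ℕ, K₀min ≤ K₀ → ∃ c₀ e₁ : ℝ, 0 < c₀ ∧ 0 < e₁ ∧
      ∀ (P : HiggsLattice.Params), P.d = d → P.L = L → K₀ ∣ P.M →
      ∀ {K : ℕ}, 1 ≤ K → K ≤ P.K → (∀ μ, 3 * half P K K₀ ≤ P.sitesPerDir 0 μ) → P.mesh K ≤ ε₀ →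
      ∀ (Ω : Finset (HiggsLattice.Site P 0)), IsBigBlockUnion K K₀ Ω →
      ∀ (A : HiggsLattice.VecField P 0) {ec : ℝ}, 0 < ec → ec ≤ e₁ →
      (∀ z ∈ Ω, ∀ μ ν : Fin P.d,
          P.mesh K * |C.e| / ec * |A ⟨z.shift μ, ν⟩ - A ⟨z, ν⟩| ≤ creg * ec ^ (β - 1) / (P.L : ℝ) ^ K) →
      ∀ (x : HiggsLattice.Site P 0),
        (∀ y, HiggsLattice.Site.tdist x y ≤ 2 * rS P K K₀ + 2 * half P K K₀ * (P.d + 1) → y ∈ Ω) →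
        ∀ (g : HiggsLattice.ScalarField P 0 N) (M D : ℝ), (∀ y, ‖g y‖ ≤ M) → 0 ≤ D →
          (∀ z, g z ≠ 0 → D ≤ (HiggsLattice.Site.tdist x z : ℝ)) →
            ‖propagatorK C Ω A msq a K (chi Ω • g) x‖
              ≤ c₀ * P.mesh K ^ 2 * Real.exp (-(D / (4 * K₀ * (P.L : ℝ) ^ K))) * M := by
  obtain ⟨c₀, hc₀, K₀min, hmain⟩ := norm_propagatorK_region_reg_decay d L hd hL ha hmsq N C ε₀ creg β hcreg hβ
  refine ⟨max K₀min 1, fun K₀ hK₀ => ?_⟩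
  have hK₀1 : 1 ≤ K₀ := le_trans (le_max_right _ _) hK₀
  have hK₀r : (0 : ℝ) < K₀ := by exact_mod_cast hK₀1
  obtain ⟨e₁, he₁, hblk⟩ := hmain K₀ (le_trans (le_max_left _ _) hK₀)
  have hrate : (0 : ℝ) < 1 / (4 * K₀) := by positivity
  have hlc : 0 < latticeConst d (1 / (4 * K₀)) := by
    unfold latticeConst
    apply pow_pos
    have hdr : (0 : ℝ) < d := by exact_mod_cast hd
    have h1 : Real.exp (-(1 / (4 * (K₀ : ℝ)) / d)) < 1 := Real.exp_lt_one_iff.2 (by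
      have := div_pos hrate hdr; linarith)
    have h2 : 0 < 1 - Real.exp (-(1 / (4 * (K₀ : ℝ)) / d)) := by linarith
    positivity
  refine ⟨c₀ * Real.exp (1 / (4 * K₀)) * latticeConst d (1 / (4 * K₀)), e₁, by positivity, he₁, ?_⟩
  · intro P hPd hPL hK₀M K hK1 hK hN3 hε Ω hΩ A ec hec hle hreg x hR g M D hgM hD0 hD
    subst hPd
    have hM0 : 0 ≤ M := (norm_nonneg _).trans (hgM x)
    have hLK : (0 : ℝ) < (P.L : ℝ) ^ K := pow_pos (by exact_mod_cast P.hL) K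
    -- split `g` over the `K`-blocks
    have hsplit : propagatorK C Ω A msq a K (chi Ω • g) x
        = ∑ b : HiggsLattice.Site P K, propagatorK C Ω A msq a K (chi Ω • blockPiece K b g) x := by
      conv_lhs => rw [← sum_blockPiece (K := K) g]
      rw [Finset.smul_sum, map_sum, Finset.sum_apply]
    rw [hsplit]
    refine (norm_sum_le _ _).trans ?_
    -- each block piece: the previous theorem with `D_b = max D (L^K(|x_K − b| − 1))`
    have hpiece : ∀ b : HiggsLattice.Site P K, ‖propagatorK C Ω A msq a K (chi Ω • blockPiece K b g) x‖
        ≤ c₀ * P.mesh K ^ 2 * (Real.exp (-(D / (4 * K₀ * (P.L : ℝ) ^ K))) * Real.exp (1 / (4 * K₀))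
            * Real.exp (-(1 / (4 * K₀) * (HiggsLattice.Site.tdist (blockIter K x) b : ℝ)))) * M := by
      intro b
      classical
      by_cases hb : ∃ y₀, blockIter K y₀ = b
      · obtain ⟨y₀, hy₀⟩ := hb
        set Db : ℝ := max D ((P.L : ℝ) ^ K * ((HiggsLattice.Site.tdist (blockIter K x) b : ℝ) - 1)) with hDb
        have hDb0 : 0 ≤ Db := hD0.trans (le_max_left _ _)
        have hfar : ∀ z, blockPiece K b g z ≠ 0 → Db ≤ (HiggsLattice.Site.tdist x z : ℝ) := by
          intro z hz
          have hzb : blockIter K z = b := by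
            by_contra h
            exact hz (by unfold blockPiece; rw [if_neg h])
          have hgz : g z ≠ 0 := fun h0 => hz (by unfold blockPiece; rw [if_pos hzb, h0])
          refine max_le (hD z hgz) ?_
          have h1 := tdist_blockIter_le_real hK x z
          rw [hzb] at h1
          rw [mul_sub, mul_one, sub_le_iff_le_add]
          have h2 : (P.L : ℝ) ^ K * (HiggsLattice.Site.tdist (blockIter K x) b : ℝ)
              ≤ (P.L : ℝ) ^ K * ((HiggsLattice.Site.tdist x z : ℝ) / (P.L : ℝ) ^ K + 1 - ((P.L : ℝ) ^ K)⁻¹) :=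
            mul_le_mul_of_nonneg_left h1 hLK.le
          have e : (P.L : ℝ) ^ K * ((HiggsLattice.Site.tdist x z : ℝ) / (P.L : ℝ) ^ K + 1 - ((P.L : ℝ) ^ K)⁻¹)
              = (HiggsLattice.Site.tdist x z : ℝ) + (P.L : ℝ) ^ K - 1 := by field_simp
          rw [e] at h2
          linarith
        have h := hblk P rfl hPL hK₀M hK1 hK hN3 hε Ω hΩ A hec hle hreg x hR y₀ (blockPiece K b g) M Db
          (blockPiece_supported b g hy₀) (fun y => (norm_blockPiece_apply_le b g y).trans (hgM y)) hDb0 hfar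
        refine h.trans (mul_le_mul_of_nonneg_right (mul_le_mul_of_nonneg_left ?_ (by positivity)) hM0)
        -- `e^{−D_b/(2K₀L^K)} ≤ e^{−D/(4K₀L^K)}·e^{1/(4K₀)}·e^{−|x_K − b|/(4K₀)}`
        rw [← Real.exp_add, ← Real.exp_add]
        refine Real.exp_le_exp.2 ?_
        have hmax : D + (P.L : ℝ) ^ K * ((HiggsLattice.Site.tdist (blockIter K x) b : ℝ) - 1) ≤ 2 * Db :=
          by rw [two_mul]; exact add_le_add (le_max_left _ _) (le_max_right _ _)
        have hK4 : (0 : ℝ) < 4 * K₀ * (P.L : ℝ) ^ K := by positivity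
        have key : (D + (P.L : ℝ) ^ K * ((HiggsLattice.Site.tdist (blockIter K x) b : ℝ) - 1)) / (4 * K₀ * (P.L : ℝ) ^ K)
            ≤ Db / (2 * K₀ * (P.L : ℝ) ^ K) :=
          calc (D + (P.L : ℝ) ^ K * ((HiggsLattice.Site.tdist (blockIter K x) b : ℝ) - 1)) / (4 * K₀ * (P.L : ℝ) ^ K)
              ≤ 2 * Db / (4 * K₀ * (P.L : ℝ) ^ K) := div_le_div_of_nonneg_right hmax hK4.le
            _ = Db / (2 * K₀ * (P.L : ℝ) ^ K) := by field_simp; ring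
        have e1 : (D + (P.L : ℝ) ^ K * ((HiggsLattice.Site.tdist (blockIter K x) b : ℝ) - 1)) / (4 * K₀ * (P.L : ℝ) ^ K)
            = D / (4 * K₀ * (P.L : ℝ) ^ K) - 1 / (4 * K₀) + 1 / (4 * K₀) * (HiggsLattice.Site.tdist (blockIter K x) b : ℝ) := by
          field_simp
          ring
        rw [e1] at key
        linarith
      · -- no site maps to `b`: the piece vanishes
        have h0 : blockPiece K b g = 0 := by
          funext y
          unfold blockPiece
          rw [if_neg (fun h => hb ⟨y, h⟩)]
          rfl
        rw [h0, smul_zero, map_zero, Pi.zero_apply, norm_zero]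
        positivity
    refine (Finset.sum_le_sum fun b _ => hpiece b).trans ?_
    rw [← Finset.sum_mul, ← Finset.mul_sum, ← Finset.mul_sum]
    have hsum := sum_exp_neg_tdist_le (P := P) (k := K) hrate (blockIter K x)
    calc c₀ * P.mesh K ^ 2 * (Real.exp (-(D / (4 * K₀ * (P.L : ℝ) ^ K))) * Real.exp (1 / (4 * K₀))
            * ∑ b : HiggsLattice.Site P K, Real.exp (-(1 / (4 * K₀) * (HiggsLattice.Site.tdist (blockIter K x) b : ℝ)))) * M
        ≤ c₀ * P.mesh K ^ 2 * (Real.exp (-(D / (4 * K₀ * (P.L : ℝ) ^ K))) * Real.exp (1 / (4 * K₀))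
            * latticeConst P.d (1 / (4 * K₀))) * M :=
          mul_le_mul_of_nonneg_right (mul_le_mul_of_nonneg_left (mul_le_mul_of_nonneg_left hsum (by positivity)) (by positivity)) hM0
      _ = c₀ * Real.exp (1 / (4 * K₀)) * latticeConst P.d (1 / (4 * K₀)) * P.mesh K ^ 2
            * Real.exp (-(D / (4 * K₀ * (P.L : ℝ) ^ K))) * M := by ring

end Sum

end Literature.MathematicalPhysics.QuantumFieldTheory.Balaban1983to89.B1Ineq225RegularRegion

end
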